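import Mathlib
import Summits.AtomisticToContinuum.Crystallization.Theses.IsometryAtoms
import Literature.Geometry.DiscreteGeometry.MultiregularPointSystems

/-!
# Birth skeleton — crux `IsometryAtoms.AtomicLawChargesCrystal` (stmt-AtomisticToContinuum-15778)

Route `route-AtomisticToContinuum-IsometryAtoms`, sub-problem `Crystallization`; crux workfile
`Cruxes/AtomicLawChargesCrystal/Lines/birth.lean` (BC3 skeleton, registered with `ledger skeleton check`).

The crux (FIXED — the route's decl and signature, never restated here): THE BRIDGE. For every hard core
`δ > 0` and every probability law `P` on rooted configurations `μ : Measure ℝ³` that is `P`-a.s.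
`IsRootedHardCore δ`, point-stationary (`IsPointStationaryLaw`, the Mecke / mass-transport identity) and
`P`-a.s. relatively dense, an ATOM MODULO ISOMETRY — a set `Y ⊆ ℝ³` whose rooted isometry class
`{count|A(Y − q) : A ∈ O(3), q ∈ Y}` has positive `P`-measure — forces ONE periodic configuration
`Q : PeriodicConfiguration 3` all of whose `(R, ε)`-windows are charged by `P` (the conclusion of the shared
crux `PeriodicSupport`).  In fact `Q.points = Y`.

## The line (the route's own proof sketch, typed; refuter evidence `Bridge15778-ProofSketch.md` and
grounder notes g49-2 / g49-8 folded in)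

Six registered stubs, each a genuine lemma stated over Mathlib / Literature / route declarations only,
none a restatement of the crux or of the summit (BC3 probes `stub → AtomicLawChargesCrystal` and
`stub → Crystallization` by `first | exact? | simpa | aesop` all FAIL — folder `bc/probe_*.lean` of the
registering session):

* `stub_deloneOfRealisedClass` (M; deterministic measure / metric bookkeeping with content).  If a rooted
  isometric copy `count|A(Y − q)` of `Y` is a `δ`-hard-core configuration (`δ > 0`) and is relatively dense,
  then `Y` carries a Mathlib `Delone.DeloneSet` structure (`count|S = count|S'` forces `S = S'` by singleton
  evaluation; separation and covering pull back along the isometry `s ↦ A(s − q)`).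
* `stub_measurableSet_isometryClass` (L; Giry measurability).  For a Delone set `D` and any `q`, the rooted
  isometry class `{count|A(D − q) : A ∈ O(3)}` is measurable in the Giry σ-algebra of `Measure ℝ³`
  (approximation by finite nets of the compact group `O(3)` tested against a countable π-system / countable
  family of tent functions; locally finite measures agreeing there are equal).  This is the "Lean cost =
  Giry measurability of class events" flagged by the route review; it is exactly what the Mecke instantiation
  of the next stub consumes.
* `stub_cubicGrowthOfChargedClass` (L; THE NEW LEVER — Palm / mass transport).  For a point-stationary
  probability law, a.s. rooted `δ`-hard-core, charging the rooted isometry class of a Delone set `D` (class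
  events measurable): some point `q ∈ D` has a `Sym(D)`-orbit of CUBIC growth about `q`
  (`c·r³ ≤ #(Sym(D)·q ∩ B̄(q, r))` for `r ≥ 1`).  Proof: the atom event is the countable disjoint union over
  orbits `a ∈ D/Sym(D)` of the class events `C_a`, so some `m(a) := P(C_a) > 0`; Mecke with
  `g(μ, y) = 1_{C_a}(μ)·1{‖y‖ ≤ r}` gives `m(a)·#(D ∩ B̄(q_a, r)) = Σ_b m(b)·#(Sym(D)q_a ∩ B̄(q_b, r))`
  (a.s. rootedness makes every re-rooted configuration landing in `C_a` come from some `C_b`); since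
  `Σ_b m(b) ≤ 1`, one ball `B̄(q_b, r)` holds `≥ m(a)·#(D ∩ B̄(q_a, r)) ≥ m(a)·c₀ r³` points of the orbit, and
  transitivity recentres it at `q_a` with radius `2r`.  The a.s. hard-core clause is used (unrooted copies
  would leak mass); relative density of `D` is used (`#(D ∩ B̄_r) ≥ c₀ r³`; the single triangular layer is the
  counterexample without it, cf. the route's CHEAPEST FALSIFIER (1)).
* `stub_finiteOrbitsOfCubicGrowth` (L; discrete geometry, NO Bieberbach).  A Delone set one of whose
  `Sym(D)`-orbits `O` has cubic growth about its point has finitely many `Sym(D)`-orbits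
  (`HasFinitelyManySymmetryOrbits`, DLS98 Def. 1.1).  Proof (refuter's Dirichlet-cell argument, made
  centre-free): the Voronoi cells `{V(o)}_{o ∈ O}` of `O` are congruent under `Sym(D)` (finite stabilisers:
  `D` affinely spans `ℝ³`), cover `ℝ³` with null overlaps, so `∫_{V(q)} #(O ∩ B_r(x)) dx ≤ s·vol B_r`, while
  cubic growth about every `o ∈ O` bounds the integrand below by `c(r/2)³` on `V(q) ∩ B_{r/2}(q)`; hence
  `vol V(q) < ∞`, and a convex cell with non-empty interior and finite volume is bounded, so `O` is
  relatively dense and `D ∩ B̄(q, M)` is a finite set of orbit representatives.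
* `stub_idealCrystalOfFiniteOrbits` (L; = the vendored named fact
  `Literature.Geometry.DiscreteGeometry.DolbilinLagariasSenechal1998_thm1_1` at `n = 3`, Dolbilin–Lagarias–
  Senechal 1998 Thm 1.1 (i)⇒(ii); Bieberbach I for `E(3)` inside, cf. the named facts
  `Literature.Geometry.DiscreteGeometry.Crystallographic.Bieberbach_first/_second`).  Delone + finitely many
  symmetry orbits ⇒ ideal crystal `D = F + L` (`IsIdealCrystal`: `L` the `ℤ`-span of a basis, `F` finite).
* `stub_periodicOfIdealCrystal` (M; packaging).  A non-empty ideal crystal is the point set of a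
  `PeriodicConfiguration 3` (lattice `span ℤ (range b)` — discrete, `IsZLattice` by Mathlib's `ZSpan`
  instances —, motif = one representative of `F` per class mod `L`, non-empty, pairwise inequivalent).

Composition (sorry-free, NOT a one-line seam; proved here): (A) EXTRACTION — a positive-measure event meets
the two a.s. events (`Measure.exists_mem_of_measure_ne_zero_of_ae`), giving one realised copy
`count|A(Y − q)` that is hard-core and relatively dense; (B) stub 1 makes `Y` Delone; (C) stubs 2 + 3 give an
orbit of cubic growth, stub 4 finitely many orbits; (D) stubs 5 + 6 give `Q : PeriodicConfiguration 3` with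
`Q.points = Y`; (E) WINDOWS — the atom event is contained in every `(R, ε)`-matching event of `Q` (same
`A`, `q`; matched points at distance `0 ≤ ε`, via `count_restrict_singleton_ne_zero_iff`), so monotonicity
of `P` transfers positivity.  `AtomicLawChargesCrystal_of_stubs : stub₁ → … → stub₆ → (body of the crux)` is the explicit implication
(conclusion = `AtomicLawChargesCrystal` unfolded, see `crux_iff`); `AtomicLawChargesCrystal_of :
AtomicLawChargesCrystal` concludes the route decl BY NAME from the six stubs (the only theorem of this file
concluding it; `sorry` only inside `stub_*`).

Disproof used: this crux has no `Disproof.lean` and no earlier `Lines/*` (`ledger crux ls`: no workfiles);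
`ledger negatives --problem AtomisticToContinuum` has no statement equal or trivially equivalent to a stub.
The known false neighbour is honoured by design: the bridge WITHOUT relative density is false (rooted
triangular layer `ℤ² × {0}`, point-stationary, hard-core, an atom, matched by no `PeriodicConfiguration 3`) —
relative density enters stub 1 (Delone) and is consumed in stub 3 (`#(D ∩ B̄_r) ≥ c₀ r³`); the a.s. hard-core
(rootedness) clause is consumed in stub 3 as well.  Hardest stub: `stub_cubicGrowthOfChargedClass` (new in
print and in tree; Mecke instantiation over `lintegral`/`tsum` of counting measures) — with
`stub_idealCrystalOfFiniteOrbits` (Bieberbach I, known but unformalised) the longest.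
-/

noncomputable section

namespace Summit.AtomisticToContinuum.Crystallization.Cruxes.AtomicLawChargesCrystal.Birth

open MeasureTheory

/-- The crux through its constant (definitional unfolding, for the reader). -/
theorem crux_iff :
    Summit.AtomisticToContinuum.Crystallization.Theses.IsometryAtoms.AtomicLawChargesCrystal ↔
      (∀ δ : ℝ, 0 < δ → ∀ P : MeasureTheory.Measure (MeasureTheory.Measure (EuclideanSpace ℝ (Fin 3))), MeasureTheory.IsProbabilityMeasure P → (∀ᵐ μ ∂P, Literature.Probability.Process.IsRootedHardCore δ μ) → Literature.Probability.Process.IsPointStationaryLaw P → (∀ᵐ μ ∂P, ∃ R₀ : ℝ, ∀ z : EuclideanSpace ℝ (Fin 3), ∃ y : EuclideanSpace ℝ (Fin 3), μ {y} ≠ 0 ∧ dist z y ≤ R₀) → (∃ Y : Set (EuclideanSpace ℝ (Fin 3)), 0 < P {μ | ∃ A : EuclideanSpace ℝ (Fin 3) →ₗᵢ[ℝ] EuclideanSpace ℝ (Fin 3), ∃ q ∈ Y, μ = (MeasureTheory.Measure.count : MeasureTheory.Measure (EuclideanSpace ℝ (Fin 3))).restrict ((fun s => A (s - q)) '' Y)})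 → ∃ Q : Literature.MathematicalPhysics.StatisticalMechanics.PeriodicConfiguration 3, ∀ R ε : ℝ, 0 < R → 0 < ε → 0 < P {μ | ∃ A : EuclideanSpace ℝ (Fin 3) →ₗᵢ[ℝ] EuclideanSpace ℝ (Fin 3), ∃ q ∈ Q.points, (∀ s ∈ Q.points, dist s q ≤ R → ∃ y : EuclideanSpace ℝ (Fin 3), μ {y} ≠ 0 ∧ dist y (A (s - q)) ≤ ε) ∧ (∀ y : EuclideanSpace ℝ (Fin 3), μ {y} ≠ 0 → ‖y‖ ≤ R → ∃ s ∈ Q.points, dist y (A (s - q)) ≤ ε)}) :=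
  Iff.rfl

/-! ## The stubs (registered obligations; signatures over Mathlib / Literature / route declarations only) -/
/-- **Stub 1 — A REALISED HARD-CORE, RELATIVELY DENSE COPY MAKES `Y` DELONE** (size M; deterministic).
If the rooted isometric copy `count|((fun s => A (s - q)) '' Y)` of `Y` is a rooted `δ`-hard-core configuration
(`δ > 0`: it is `count|S` for a `δ`-separated `S ∋ 0`) and is relatively dense (every point of `ℝ³` within `R₀`
of one of its points), then `Y` is (the carrier of) a Mathlib `Delone.DeloneSet` (packing radius `δ/2`,
covering radius `max R₀ 1`).  Why plausibly true: `count|S = count|S'` forces `S = S'`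
(`count_restrict_singleton_ne_zero_iff`), and separation / covering pull back along the isometry
`s ↦ A (s - q)` (no surjectivity of `A` needed).  Why it might fail: only through a junk-value slip (it does
not: `δ > 0` is assumed and the covering radius is clamped below by `1`).  Leans on:
`Literature.Probability.Process.IsRootedHardCore`, `count_restrict_singleton_ne_zero_iff`,
`Delone.DeloneSet`, `Metric.IsSeparated`, `Metric.IsCover`. -/
theorem stub_deloneOfRealisedClass : ∀ δ : ℝ, 0 < δ → ∀ (Y : Set (EuclideanSpace ℝ (Fin 3))) (A : EuclideanSpace ℝ (Fin 3) →ₗᵢ[ℝ] EuclideanSpace ℝ (Fin 3)) (q : EuclideanSpace ℝ (Fin 3)), Literature.Probability.Process.IsRootedHardCore δ ((MeasureTheory.Measure.count : MeasureTheory.Measure (EuclideanSpace ℝ (Fin 3))).restrict ((fun s => A (s - q)) '' Y)) → (∃ R₀ : ℝ, ∀ z : EuclideanSpace ℝ (Fin 3), ∃ y : EuclideanSpace ℝ (Fin 3), ((MeasureTheory.Measure.count : MeasureTheory.Measure (EuclideanSpace ℝ (Fin 3))).restrict ((fun s => A (s - q)) '' Y)) {y} ≠ 0 ∧ dist z y ≤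 R₀) → ∃ D : Delone.DeloneSet (EuclideanSpace ℝ (Fin 3)), (D : Set (EuclideanSpace ℝ (Fin 3))) = Y := by
  sorry

/-- **Stub 2 — GIRY MEASURABILITY OF A ROOTED ISOMETRY CLASS** (size L; pure measure theory).
For a Delone set `D ⊆ ℝ³` and any `q`, the set of configurations `{count|A(D − q) : A a linear isometry}`
is measurable in `MeasureTheory.Measure.instMeasurableSpace` (generated by the evaluations `μ ↦ μ B`).
Why plausibly true: `A ↦ count|A(D − q)` is a continuous (vague) finite-to-one image of the compact group
`O(3)`; concretely the class is cut out by countably many evaluation / integral conditions — for every `k`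
some `A` in a finite `1/k²`-net of `O(3)` matches `μ` against the first `k` members of a countable family of
compactly supported tent functions (or of a countable π-system of rational boxes with `1/k`-collars), and a
limit point `A` of the net elements gives `μ = count|A(D − q)` by uniqueness of locally finite measures on a
generating π-system.  Why it might fail: if the evaluation σ-algebra on ALL of `Measure ℝ³` (not only on
locally finite counting measures) were too coarse to single out counting measures — it is not: local
finiteness and `ℕ`-valuedness on rational balls are evaluation conditions.  Leans on:
`MeasureTheory.Measure.instMeasurableSpace`, `Measure.ext_of_generateFrom_of_iUnion`, compactness of
`O(3)` (`LinearIsometry` of `EuclideanSpace ℝ (Fin 3)`), LastPenrose2017 Ch. 2/6 (measurability of simple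
counting measures). -/
theorem stub_measurableSet_isometryClass : ∀ (D : Delone.DeloneSet (EuclideanSpace ℝ (Fin 3))) (q : EuclideanSpace ℝ (Fin 3)), MeasurableSet {μ : MeasureTheory.Measure (EuclideanSpace ℝ (Fin 3)) | ∃ A : EuclideanSpace ℝ (Fin 3) →ₗᵢ[ℝ] EuclideanSpace ℝ (Fin 3), μ = (MeasureTheory.Measure.count : MeasureTheory.Measure (EuclideanSpace ℝ (Fin 3))).restrict ((fun s => A (s - q)) '' (D : Set (EuclideanSpace ℝ (Fin 3))))} := by
  sorry

/-- **Stub 3 — MASS TRANSPORT: A CHARGED ISOMETRY CLASS HAS AN ORBIT OF CUBIC GROWTH** (size L; THE NEW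
LEVER of the route, no printed counterpart).  For `δ > 0` and a point-stationary probability law `P`, a.s.
rooted `δ`-hard-core, and a Delone set `D` whose rooted isometry classes are measurable events and whose
atom event `{count|A(D − q) : A, q ∈ D}` has positive `P`-measure: some `q ∈ D` and `c > 0` satisfy
`c·r³ ≤ #{p ∈ Sym(D)·q : dist p q ≤ r}` for all `r ≥ 1`, where `Sym(D)·q = {g q : g : ℝ³ ≃ᵃⁱ[ℝ] ℝ³, g(D) = D}`.
Why plausibly true (Mecke / Aldous–Lyons mass transport): the atom event is the countable disjoint union of
the class events `C_a` over orbits `a ∈ D/Sym(D)`, so `m(a) := P(C_a) > 0` for some `a`; the Mecke identity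
with `g(μ, y) = 1_{C_a}(μ)·1{‖y‖ ≤ r}` reads `m(a)·#(D ∩ B̄(q_a, r)) = Σ_b m(b)·#(Sym(D)q_a ∩ B̄(q_b, r))`
(re-rooting `count|A(D − s₀)` at its point `A(s − s₀)` gives `count|A(D − s)`, in `C_a` iff `s ∈ Sym(D)q_a`;
a.s. rootedness excludes unrooted copies); as `Σ_b m(b) ≤ 1`, some ball of radius `r` holds
`≥ m(a)·#(D ∩ B̄(q_a, r)) ≥ m(a)·c₀·r³` orbit points (relative density of `D`), and transitivity of `Sym(D)` on
the orbit recentres it at `q_a` with radius `2r`.  Why it might fail: the `lintegral`/`tsum` bookkeeping of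
the Mecke instantiation needs the inner integrals over `count|S` as sums over the countable `S` and the
orbit decomposition to be measurable (hypothesis); mathematically the graph analogue is false (canopy tree)
but the Euclidean statement only needs `Σ_b m(b) ≤ 1` and cubic volume growth — no gap known.  Leans on:
`Literature.Probability.Process.IsPointStationaryLaw` (+ `map_sub_count_restrict`,
`IsRootedHardCore.map_sub`, `count_restrict_singleton_ne_zero_iff`), `Delone.DeloneSet`,
`LinearIsometry.toLinearIsometryEquiv`, `AffineIsometryEquiv`; HevelingLast2005, LastPenrose2017 Thm 9.6 /
(9.16)–(9.19), AldousLyons2007 §2. -/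
theorem stub_cubicGrowthOfChargedClass : ∀ δ : ℝ, 0 < δ → ∀ P : MeasureTheory.Measure (MeasureTheory.Measure (EuclideanSpace ℝ (Fin 3))), MeasureTheory.IsProbabilityMeasure P → (∀ᵐ μ ∂P, Literature.Probability.Process.IsRootedHardCore δ μ) → Literature.Probability.Process.IsPointStationaryLaw P → ∀ D : Delone.DeloneSet (EuclideanSpace ℝ (Fin 3)), (∀ q : EuclideanSpace ℝ (Fin 3), MeasurableSet {μ : MeasureTheory.Measure (EuclideanSpace ℝ (Fin 3)) | ∃ A : EuclideanSpace ℝ (Fin 3) →ₗᵢ[ℝ] EuclideanSpace ℝ (Fin 3), μ = (MeasureTheory.Measure.count : MeasureTheory.Measure (EuclideanSpace ℝ (Fin 3))).restrict ((fun s => A (s - q)) '' (D : Set (EuclideanSpace ℝ (Fin 3))))}) → 0 < P {μ | ∃ A : EuclideanSpace ℝ (Fin 3) →ₗᵢ[ℝ] EuclideanSpace ℝ (Fin 3), ∃ q ∈ (D : Set (EuclideanSpace ℝ (Fin 3))), μ = (MeasureTheory.Measure.count : MeasureTheory.Measure (EuclideanSpace ℝ (Fin 3))).restrict ((fun s =>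 A (s - q)) '' (D : Set (EuclideanSpace ℝ (Fin 3))))} → ∃ q ∈ (D : Set (EuclideanSpace ℝ (Fin 3))), ∃ c : ℝ, 0 < c ∧ ∀ r : ℝ, 1 ≤ r → c * r ^ 3 ≤ (Nat.card {p : EuclideanSpace ℝ (Fin 3) // (∃ g : EuclideanSpace ℝ (Fin 3) ≃ᵃⁱ[ℝ] EuclideanSpace ℝ (Fin 3), g '' (D : Set (EuclideanSpace ℝ (Fin 3))) = (D : Set (EuclideanSpace ℝ (Fin 3))) ∧ g q = p) ∧ dist p q ≤ r} : ℝ) := by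
  sorry

/-- **Stub 4 — AN ORBIT OF CUBIC GROWTH FORCES FINITELY MANY SYMMETRY ORBITS** (size L; discrete
geometry, no Bieberbach).  A Delone set `D ⊆ ℝ³` with a point `q ∈ D` whose `Sym(D)`-orbit `O` satisfies
`c·r³ ≤ #(O ∩ B̄(q, r))` (`r ≥ 1`) has finitely many `Sym(D)`-orbits (`HasFinitelyManySymmetryOrbits`,
Dolbilin–Lagarias–Senechal Def. 1.1: a finite set of representatives reached by set-preserving affine
isometries).  Why plausibly true (the route review's Dirichlet-cell argument): the Voronoi cells `V(o)`,
`o ∈ O`, are convex, congruent under `Sym(D)` (stabilisers finite since `D` affinely spans `ℝ³`), cover `ℝ³`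
and overlap in null sets, so `∫_{V(q)} #(O ∩ B_r(x)) dx = Σ_{o ∈ O} vol(V(q) ∩ B_r(o)) ≤ s·vol(B_r)`, while
cubic growth about every point of `O` (transitivity) bounds the integrand below by `c (r/2)³` on
`V(q) ∩ B_{r/2}(q)`; hence `vol V(q) ≤ 8·s·(4π/3)/c`, a convex set with an interior ball and finite volume is
bounded, `O` is relatively dense with some radius `M`, and `D ∩ B̄(q, M)` (finite by uniform discreteness) is
a set of orbit representatives.  Why it might fail: only if `Sym(D)` had infinite point stabilisers (excluded:
a relatively dense set spans) — no gap known; Lean cost is the Voronoi measure theory.  Leans on: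
`Delone.DeloneSet`, `MeasureTheory.Measure.addHaar` invariance under `AffineIsometryEquiv`,
`Convex`, `Literature.Geometry.DiscreteGeometry.HasFinitelyManySymmetryOrbits`; DolbilinLagariasSenechal1998
§2. -/
theorem stub_finiteOrbitsOfCubicGrowth : ∀ D : Delone.DeloneSet (EuclideanSpace ℝ (Fin 3)), (∃ q ∈ (D : Set (EuclideanSpace ℝ (Fin 3))), ∃ c : ℝ, 0 < c ∧ ∀ r : ℝ, 1 ≤ r → c * r ^ 3 ≤ (Nat.card {p : EuclideanSpace ℝ (Fin 3) // (∃ g : EuclideanSpace ℝ (Fin 3) ≃ᵃⁱ[ℝ] EuclideanSpace ℝ (Fin 3), g '' (D : Set (EuclideanSpace ℝ (Fin 3))) = (D : Set (EuclideanSpace ℝ (Fin 3))) ∧ g q = p) ∧ dist p q ≤ r} : ℝ)) → Literature.Geometry.DiscreteGeometry.HasFinitelyManySymmetryOrbits (D : Set (EuclideanSpace ℝ (Fin 3))) := by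
  sorry

/-- **Stub 5 — MULTIREGULAR ⇒ IDEAL CRYSTAL in `ℝ³`** (size L; KNOWN in print, unformalised: the `n = 3`
instance of the vendored named fact `Literature.Geometry.DiscreteGeometry.DolbilinLagariasSenechal1998_thm1_1`,
Dolbilin–Lagarias–Senechal 1998 Thm 1.1 (i)⇒(ii)).  A Delone set with finitely many `Sym(D)`-orbits is a
finite union of translates of a full lattice: `D = F + span_ℤ(b)` (`IsIdealCrystal`).  Why plausibly true:
printed theorem; proof = one orbit is relatively dense ⇒ `Sym(D)` is discrete and cocompact ⇒ Bieberbach I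
(`Literature.Geometry.DiscreteGeometry.Crystallographic.Bieberbach_first 3`: three independent translations)
⇒ the translation vectors of `Sym(D)` form a full lattice `L` (`Bieberbach_second`) ⇒ `D`, discrete and
`L`-invariant, is `F + L` with `F = D ∩ (fundamental cell)` finite.  Why it might fail: it cannot as
mathematics (published, standard); the risk is size — Bieberbach I for `E(3)` is not in Mathlib.  Leans on:
`DolbilinLagariasSenechal1998_thm1_1` (statement), `Bieberbach_first`, `Bieberbach_second` (named facts, to
be proved or specialised), `ZSpan`, `IsZLattice`; GrahamGrotschelLovasz1996 ch. 19 Thms 5.1–5.2, Wolf2011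
§3.2, Buser 1985 (geometric proof of Bieberbach). -/
theorem stub_idealCrystalOfFiniteOrbits : ∀ D : Delone.DeloneSet (EuclideanSpace ℝ (Fin 3)), Literature.Geometry.DiscreteGeometry.HasFinitelyManySymmetryOrbits (D : Set (EuclideanSpace ℝ (Fin 3))) → Literature.Geometry.DiscreteGeometry.IsIdealCrystal (D : Set (EuclideanSpace ℝ (Fin 3))) := by
  sorry

/-- **Stub 6 — A NON-EMPTY IDEAL CRYSTAL IS THE POINT SET OF A `PeriodicConfiguration 3`** (size M;
packaging).  If `Y = {x + v : x ∈ F, v ∈ span_ℤ(range b)}` for a basis `b` of `ℝ³` and a finite `F`, and `Y`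
is non-empty, then `Y = Q.points` for some `Q : PeriodicConfiguration 3` (Blanc–Lewin (17)–(18): full-rank
discrete lattice of periods + finite non-empty motif of pairwise inequivalent points).  Why plausibly true:
take `Q.lattice := span ℤ (range b)` (discrete and `IsZLattice` by Mathlib's `ZSpan` instances) and
`Q.motif :=` one representative of `F` per class modulo the lattice (non-empty since `Y` is); then
`Q.points = F' + L = F + L = Y`.  Why it might fail: only through the side conditions of the structure
(`motif_nonempty` needs `Y ≠ ∅`, assumed; `eq_of_sub_mem` needs the choice of representatives) — no gap.
Leans on: `Literature.MathematicalPhysics.StatisticalMechanics.PeriodicConfiguration` (+ `.points`),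
`Literature.Geometry.DiscreteGeometry.IsIdealCrystal`, `ZSpan.instDiscreteTopology…`, `ZSpan.isZLattice`. -/
theorem stub_periodicOfIdealCrystal : ∀ Y : Set (EuclideanSpace ℝ (Fin 3)), Y.Nonempty → Literature.Geometry.DiscreteGeometry.IsIdealCrystal Y → ∃ Q : Literature.MathematicalPhysics.StatisticalMechanics.PeriodicConfiguration 3, Q.points = Y := by
  sorry


/-! ## Composition (sorry-free) -/

/-- **Composition with explicit hypotheses `AtomicLawChargesCrystal_of_stubs`** (sorry-free): the six
registered stubs' STATEMENTS, verbatim, imply the BODY of the crux verbatim (`AtomicLawChargesCrystal`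
unfolded — see `crux_iff`; the by-name form is `AtomicLawChargesCrystal_of` below, the `ledger skeleton check`
shape: no hypotheses, `sorry` only inside `stub_*`).  Steps proved here: (A) extraction of one
realised hard-core, relatively dense copy of `Y` from the positive-measure atom event and the two a.s.
clauses; (E) the atom event is contained in every `(R, ε)`-matching event of `Q` once `Q.points = Y`. -/
theorem AtomicLawChargesCrystal_of_stubs :
    (∀ δ : ℝ, 0 < δ → ∀ (Y : Set (EuclideanSpace ℝ (Fin 3))) (A : EuclideanSpace ℝ (Fin 3) →ₗᵢ[ℝ] EuclideanSpace ℝ (Fin 3)) (q : EuclideanSpace ℝ (Fin 3)), Literature.Probability.Process.IsRootedHardCore δ ((MeasureTheory.Measure.count : MeasureTheory.Measure (EuclideanSpace ℝ (Fin 3))).restrict ((fun s => A (s - q)) '' Y)) → (∃ R₀ : ℝ, ∀ z : EuclideanSpace ℝ (Fin 3), ∃ y : EuclideanSpace ℝ (Fin 3), ((MeasureTheory.Measure.count : MeasureTheory.Measure (EuclideanSpace ℝ (Fin 3))).restrict ((fun s => A (s - q)) '' Y)) {y} ≠ 0 ∧ dist z y ≤ R₀) → ∃ D : Delone.DeloneSet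 (EuclideanSpace ℝ (Fin 3)), (D : Set (EuclideanSpace ℝ (Fin 3))) = Y) →
    (∀ (D : Delone.DeloneSet (EuclideanSpace ℝ (Fin 3))) (q : EuclideanSpace ℝ (Fin 3)), MeasurableSet {μ : MeasureTheory.Measure (EuclideanSpace ℝ (Fin 3)) | ∃ A : EuclideanSpace ℝ (Fin 3) →ₗᵢ[ℝ] EuclideanSpace ℝ (Fin 3), μ = (MeasureTheory.Measure.count : MeasureTheory.Measure (EuclideanSpace ℝ (Fin 3))).restrict ((fun s => A (s - q)) '' (D : Set (EuclideanSpace ℝ (Fin 3))))}) →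
    (∀ δ : ℝ, 0 < δ → ∀ P : MeasureTheory.Measure (MeasureTheory.Measure (EuclideanSpace ℝ (Fin 3))), MeasureTheory.IsProbabilityMeasure P → (∀ᵐ μ ∂P, Literature.Probability.Process.IsRootedHardCore δ μ) → Literature.Probability.Process.IsPointStationaryLaw P → ∀ D : Delone.DeloneSet (EuclideanSpace ℝ (Fin 3)), (∀ q : EuclideanSpace ℝ (Fin 3), MeasurableSet {μ : MeasureTheory.Measure (EuclideanSpace ℝ (Fin 3)) | ∃ A : EuclideanSpace ℝ (Fin 3) →ₗᵢ[ℝ] EuclideanSpace ℝ (Fin 3), μ = (MeasureTheory.Measure.count : MeasureTheory.Measure (EuclideanSpace ℝ (Fin 3))).restrict ((fun s => A (s - q)) '' (D : Set (EuclideanSpace ℝ (Fin 3))))}) → 0 < P {μ | ∃ A : EuclideanSpace ℝ (Fin 3) →ₗᵢ[ℝ] EuclideanSpace ℝ (Fin 3), ∃ q ∈ (D : Set (EuclideanSpace ℝ (Fin 3))), μ = (MeasureTheory.Measure.count : MeasureTheory.Measure (EuclideanSpace ℝ (Fin 3))).restrict ((fun s => A (s - q)) '' (D : Set (EuclideanSpace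 ℝ (Fin 3))))} → ∃ q ∈ (D : Set (EuclideanSpace ℝ (Fin 3))), ∃ c : ℝ, 0 < c ∧ ∀ r : ℝ, 1 ≤ r → c * r ^ 3 ≤ (Nat.card {p : EuclideanSpace ℝ (Fin 3) // (∃ g : EuclideanSpace ℝ (Fin 3) ≃ᵃⁱ[ℝ] EuclideanSpace ℝ (Fin 3), g '' (D : Set (EuclideanSpace ℝ (Fin 3))) = (D : Set (EuclideanSpace ℝ (Fin 3))) ∧ g q = p) ∧ dist p q ≤ r} : ℝ)) →
    (∀ D : Delone.DeloneSet (EuclideanSpace ℝ (Fin 3)), (∃ q ∈ (D : Set (EuclideanSpace ℝ (Fin 3))), ∃ c : ℝ, 0 < c ∧ ∀ r : ℝ, 1 ≤ r → c * r ^ 3 ≤ (Nat.card {p : EuclideanSpace ℝ (Fin 3) // (∃ g : EuclideanSpace ℝ (Fin 3) ≃ᵃⁱ[ℝ] EuclideanSpace ℝ (Fin 3), g '' (D : Set (EuclideanSpace ℝ (Fin 3))) = (D : Set (EuclideanSpace ℝ (Fin 3))) ∧ g q = p) ∧ dist p q ≤ r} : ℝ)) → Literature.Geometry.DiscreteGeometry.HasFinitelyManySymmetryOrbits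 (D : Set (EuclideanSpace ℝ (Fin 3)))) →
    (∀ D : Delone.DeloneSet (EuclideanSpace ℝ (Fin 3)), Literature.Geometry.DiscreteGeometry.HasFinitelyManySymmetryOrbits (D : Set (EuclideanSpace ℝ (Fin 3))) → Literature.Geometry.DiscreteGeometry.IsIdealCrystal (D : Set (EuclideanSpace ℝ (Fin 3)))) →
    (∀ Y : Set (EuclideanSpace ℝ (Fin 3)), Y.Nonempty → Literature.Geometry.DiscreteGeometry.IsIdealCrystal Y → ∃ Q : Literature.MathematicalPhysics.StatisticalMechanics.PeriodicConfiguration 3, Q.points = Y) →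
    (∀ δ : ℝ, 0 < δ → ∀ P : MeasureTheory.Measure (MeasureTheory.Measure (EuclideanSpace ℝ (Fin 3))), MeasureTheory.IsProbabilityMeasure P → (∀ᵐ μ ∂P, Literature.Probability.Process.IsRootedHardCore δ μ) → Literature.Probability.Process.IsPointStationaryLaw P → (∀ᵐ μ ∂P, ∃ R₀ : ℝ, ∀ z : EuclideanSpace ℝ (Fin 3), ∃ y : EuclideanSpace ℝ (Fin 3), μ {y} ≠ 0 ∧ dist z y ≤ R₀) → (∃ Y : Set (EuclideanSpace ℝ (Fin 3)), 0 < P {μ | ∃ A : EuclideanSpace ℝ (Fin 3) →ₗᵢ[ℝ] EuclideanSpace ℝ (Fin 3), ∃ q ∈ Y, μ = (MeasureTheory.Measure.count : MeasureTheory.Measure (EuclideanSpace ℝ (Fin 3))).restrict ((fun s => A (s - q)) '' Y)}) → ∃ Q : Literature.MathematicalPhysics.StatisticalMechanics.PeriodicConfiguration 3, ∀ R ε : ℝ, 0 < R → 0 < ε → 0 < P {μ | ∃ A : EuclideanSpace ℝ (Fin 3) →ₗᵢ[ℝ] EuclideanSpace ℝ (Fin 3), ∃ q ∈ Q.points, (∀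 s ∈ Q.points, dist s q ≤ R → ∃ y : EuclideanSpace ℝ (Fin 3), μ {y} ≠ 0 ∧ dist y (A (s - q)) ≤ ε) ∧ (∀ y : EuclideanSpace ℝ (Fin 3), μ {y} ≠ 0 → ‖y‖ ≤ R → ∃ s ∈ Q.points, dist y (A (s - q)) ≤ ε)}) := by
  intro h1 h2 h3 h4 h5 h6 δ hδ P hP hHC hSt hRD hAtom
  obtain ⟨Y, hY⟩ := hAtom
  -- (A) EXTRACTION: the atom event has positive measure, the hard-core and relative-density clauses hold
  -- a.s., so one configuration in the atom event satisfies both.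
  obtain ⟨μ, ⟨A, q, hq, rfl⟩, hμhc, hμrd⟩ :=
    MeasureTheory.Measure.exists_mem_of_measure_ne_zero_of_ae hY.ne'
      (MeasureTheory.ae_restrict_of_ae (hHC.and hRD))
  -- (B) stub 1: `Y` is a Delone set.
  obtain ⟨D, hDY⟩ := h1 δ hδ Y A q hμhc hμrd
  subst hDY
  -- (C) stubs 2 + 3: an orbit of cubic growth; stub 4: finitely many symmetry orbits.
  have hfin := h4 D (h3 δ hδ P hP hHC hSt D (h2 D) hY)
  -- (D) stubs 5 + 6: `Y = Q.points` for a periodic configuration `Q`.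
  obtain ⟨Q, hQ⟩ := h6 (D : Set (EuclideanSpace ℝ (Fin 3))) ⟨q, hq⟩ (h5 D hfin)
  -- (E) WINDOWS: the atom event lies inside every matching event of `Q`.
  refine ⟨Q, fun R ε hR hε => lt_of_lt_of_le hY (MeasureTheory.measure_mono ?_)⟩
  rintro μ ⟨A', q', hq', rfl⟩
  refine ⟨A', q', ?_, ?_, ?_⟩
  · rw [hQ]; exact hq'
  · intro s hs _
    refine ⟨A' (s - q'), ?_, (dist_self _).trans_le hε.le⟩
    rw [Literature.Probability.Process.count_restrict_singleton_ne_zero_iff]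
    exact ⟨s, hQ ▸ hs, rfl⟩
  · intro y hy _
    rw [Literature.Probability.Process.count_restrict_singleton_ne_zero_iff] at hy
    obtain ⟨s, hs, rfl⟩ := hy
    refine ⟨s, ?_, (dist_self _).trans_le hε.le⟩
    rw [hQ]; exact hs

/-- **SKELETON THEOREM `AtomicLawChargesCrystal_of` — the crux BY NAME from the six registered stubs**
(the only theorem of this file concluding `IsometryAtoms.AtomicLawChargesCrystal`; no hypotheses; its only
`sorry`s are the ones inside `stub_*`). -/
theorem AtomicLawChargesCrystal_of :
    Summit.AtomisticToContinuum.Crystallization.Theses.IsometryAtoms.AtomicLawChargesCrystal :=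
  crux_iff.mpr
    (AtomicLawChargesCrystal_of_stubs stub_deloneOfRealisedClass stub_measurableSet_isometryClass
      stub_cubicGrowthOfChargedClass stub_finiteOrbitsOfCubicGrowth stub_idealCrystalOfFiniteOrbits
      stub_periodicOfIdealCrystal)

end Summit.AtomisticToContinuum.Crystallization.Cruxes.AtomicLawChargesCrystal.Birth

end
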